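import Literature.NumberTheory.Automorphic.FLSResidualImageCriteria
import HarnessLib

/-!
# Thorne 2016, Theorem 7.5 (= Thm. 1.2): automorphy of residually dihedral `ρ_{E,p}` over a
# totally real field, without the Taylor–Wiles hypothesis (named fact)

Topic `Literature/NumberTheory/Automorphic`.  ONE named fact, no proofs.

J. A. Thorne, *Automorphy of some residually dihedral Galois representations*, Math. Ann. 364
(2016) 589–648 (= arXiv:1504.00994), **Theorem 7.5** (= Thm. 1.2; p. 36 of the held text
`paper:arxiv-1504.00994`): "Let `F` be a totally real number field, let `p` be an odd prime,
and let `ρ : G_F → GL₂(ℚ̄_p)` be a continuous representation satisfying the following conditions.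
• The representation `ρ` is almost everywhere unramified. • For each place `v | p` of `F`,
`ρ|_{G_{F_v}}` is de Rham. For each embedding `τ : F ↪ ℚ̄_p`, we have `HT_τ(ρ) = {0, 1}`. • For
each complex conjugation `c ∈ G_F`, we have `det ρ(c) = -1`. • The residual representation `ρ̄`
is absolutely irreducible, yet `ρ̄|_{G_{F(ζ_p)}}` is a direct sum of two distinct characters. The
unique quadratic subfield `K` of `F(ζ_p)/F` is totally real. Then `ρ` is automorphic: there
exists a cuspidal automorphic representation `π` of `GL₂(𝔸_F)` of weight 2, an isomorphism
`ι : ℚ̄_p → ℂ`, and an isomorphism `ρ ≅ r_ι(π)`."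

The statement below is Thm. 7.5 for `ρ = ρ_{E,p}`, `E` an elliptic curve over the totally real
`F` — the first three conditions then hold for every `E` (unramified outside `p Δ(E) ∞`; de Rham
with `HT_τ = {0,1}`; `det ρ_{E,p} = ε_p⁻¹` totally odd), which is how the printed proof of
Thm. 7.6 applies it — on the tree's carriers, binder for binder those of the `p = 7` analogue
`Kalyanswamy2018_theorem1_2` (`FLSResidualImageCriteria`): hypothesis (T) of the module docstring
of `ThorneQInfinityModularTheorem2Proofs.lean`.  It is, character for character, the hypothesis
`hT` shared by the ACCEPTED reductions `Thorne2016_theorem7_6_of_dihedralLifting`,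
`Thorne2019_thm2_five_of_dihedralLifting` (`ThorneQInfinityModularTheorem2Proofs.lean`, p153167)
and `Box2022_theorem1_3_of_liftingTheorems` (`TotallyRealModularityBoxImagesProofs.lean`,
p156056), vendored as a named fact at the request of promote events 4317157 / 4377540 (the
provefact units of `Thorne2019_thm2_five` and `Box2022_theorem1_3`; librarian sweep g40,
2026-08-17): with it `Thorne2019_thm2_five` is one line modulo `FLS2015_theorem3`, and
`Box2022_theorem1_3` one line modulo `FLS2015_theorem3/4` and `Kalyanswamy2018_theorem1_2`
(`FLS2015_prop9_1c` being proved).  Triage XL: the source's proof (§§3–7) is Taylor–Wiles–Kisin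
patching without the Taylor–Wiles hypothesis; no carrier for it exists in the tree.
Deliberately NOT here: the general `ρ : G_F → GL₂(ℚ̄_p)` form (no `p`-adic Hodge theory carrier),
any proof.

## References

* J. A. Thorne, *Automorphy of some residually dihedral Galois representations*, Math. Ann. 364
  (2016) 589–648, doi:10.1007/s00208-015-1214-z; arXiv:1504.00994: Thm. 7.5 (= Thm. 1.2), p. 36,
  and the proof of Thm. 7.6, p. 37, of the held text. [Thorne2016]
* P. L. Kalyanswamy, *Remarks on automorphy of residually dihedral representations*, Math. Res.
  Lett. 25 (2018), Thm. 1.2 (the `p = 7` analogue; tree `Kalyanswamy2018_theorem1_2`).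
  [Kalyanswamy2018]
* J.-P. Serre, Invent. Math. 15 (1972), §2.1 (split Cartan subgroup; tree
  `Serre1972.diagonalSubgroup`). [Serre1972]
-/

open scoped NumberField MatrixGroups

open NumberField Field Matrix

noncomputable section

namespace Literature.NumberTheory.Automorphic

open Literature.NumberTheory.GaloisRepresentations

/-- **Thorne 2016, Thm. 7.5 (= Thm. 1.2) for the `p`-torsion of an elliptic curve.**  For `F`
totally real, `p ≠ 2` prime, `E / 𝓞 F` with `Δ(E) ≠ 0`, a framing `ρ̄` of the Galois action on
`(E ⊗ F)[p]` (`WeierstrassCurve.IsTorsionGaloisRep`) which is absolutely irreducible, and a model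
`L` of `F(ζ_p)` (`IsCyclotomicExtension {p} F L`) such that (a) "`ρ̄|_{G_{F(ζ_p)}}` is a direct
sum of two distinct characters": after a base change `f : 𝔽_p → k` and a change of basis
`Q ∈ GL₂(k)` every `Q ρ̄(τ) Q⁻¹`, `τ ∈ Γ_L`, is diagonal (`Serre1972.diagonalSubgroup k`) and some
`τ` has distinct diagonal entries, and (b) "the unique quadratic subfield of `F(ζ_p)/F` is
totally real": some totally real `M`, quadratic over `F`, embeds `F`-linearly in `L` — `E` is
automorphic of weight zero (`IsAutomorphicOfWeightZero E`, the rendering of "`ρ_{E,p} ≅ r_ι(π)`,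
`π` cuspidal of weight 2" shared by `FLS2015_theorem3` and `Kalyanswamy2018_theorem1_2`).  The
remaining printed hypotheses of Thm. 7.5 (a.e. unramified, de Rham with `HT_τ = {0,1}`, totally
odd) hold for every `ρ_{E,p}`.  Verbatim the hypothesis `hT` of
`Thorne2016_theorem7_6_of_dihedralLifting`, `Thorne2019_thm2_five_of_dihedralLifting` and
`Box2022_theorem1_3_of_liftingTheorems`.
[cite: Thorne2016, Thm. 7.5 (= Thm. 1.2), p. 36 of arXiv:1504.00994; proof of Thm. 7.6 (p. 37)] -/
def Thorne2016_theorem7_5_ellipticCurve : Prop :=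
  ∀ (F : Type) [Field F] [NumberField F] [IsTotallyReal F] (p : ℕ) [Fact p.Prime], p ≠ 2 →
    ∀ (E : WeierstrassCurve (𝓞 F)), E.Δ ≠ 0 →
      ∀ ρ : ModPGaloisRep F (ZMod p) 2, (E.baseChange F).IsTorsionGaloisRep p ρ →
        FramedRep.IsAbsolutelyIrreducible ρ →
        ∀ (L : Type) [Field L] [Algebra F L] [IsCyclotomicExtension {p} F L],
          (∃ (k : Type) (_ : Field k) (f : ZMod p →+* k) (Q : GL (Fin 2) k),
              (∀ τ : absoluteGaloisGroup L,
                Q * Matrix.GeneralLinearGroup.map f (FramedGaloisRep.restrictField L ρ τ) * Q⁻¹ ∈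
                  Serre1972.diagonalSubgroup k) ∧
              ∃ τ : absoluteGaloisGroup L,
                ((Q * Matrix.GeneralLinearGroup.map f (FramedGaloisRep.restrictField L ρ τ) *
                    Q⁻¹ : GL (Fin 2) k) : Matrix (Fin 2) (Fin 2) k) 0 0 ≠
                  ((Q * Matrix.GeneralLinearGroup.map f (FramedGaloisRep.restrictField L ρ τ) *
                    Q⁻¹ : GL (Fin 2) k) : Matrix (Fin 2) (Fin 2) k) 1 1) →
          (∃ (M : Type) (_ : Field M) (_ : Algebra F M),
              Module.finrank F M = 2 ∧ IsTotallyReal M ∧ Nonempty (M →ₐ[F] L)) →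
          IsAutomorphicOfWeightZero E

end Literature.NumberTheory.Automorphic

end
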